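import Literature.InformationTheory.QuantumCodes.QuantumExpanderRobustnessProjection
import HarnessLib

/-!
# Quantum expander codes: the small-set-flip decoder corrects every error of weight
# `≤ min(γ_A n_A, γ_B n_B)/(1 + max(Δ_A, Δ_B))` — three times LTZ15 Theorem 2's radius — PROOF by the
# projection invariant

Index of sources: `[cite: LeverrierTillichZemor2015]` = Leverrier–Tillich–Zémor, FOCS 2015 / arXiv:1504.00822v1: Thm 2
(p0006 L15-22: "decodes any quantum error pattern of weight less than `w₀ = min(γ_A n_A, γ_B n_B)/(3(1+Δ_B))`"),
Lemma 10 and its proof (p0009 L40-75: the invariant (eq:epsilon) `|ε_i| < min(γ_A n_A, γ_B n_B)` maintained through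
`|ε_{i+1}| ≤ |e| + |e₁| + ⋯ + |e_{i+1}| ≤ |e| + 3|σ_X(e)| ≤ |e| + 3Δ_B|e|`), §3 (p0007: the algorithm — flip inside a
generator any pattern that strictly decreases the syndrome weight, ratio maximal), Lemma 7 / App. A (p0012).

Venture QEC (`Summits/Ventures/QEC/Expanders`), PARTITION item 149 «04.RAD3» (`prover-qec-type-04`, gen 7; placement under
Summits by qec-lead g9 block 224 (4): a statement stronger than print), follow-on to «04.COR9»
(`Literature/InformationTheory/QuantumCodes/QuantumExpanderRobustnessProjection.lean`).
The printed Lemma 10 keeps the iterates `ε_i = e ⊕ F₀ ⊕ ⋯ ⊕ F_{i−1}` of a decoder run inside the Lemma-7 ball by their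
WEIGHT, paying `|F_i| ≤ 3·(decrease)` per step (hence the factor `3` in `w₀`) and needing the ratio-`1/3` guarantee of
Lemma 8 for the decoder's own flips. With the projection form of Lemma 7 (`exists_isCritical_of_proj`) one counts STEPS
instead: every flip of ANY small-set-flip run lies inside one generator `g_{b'a'}`, so it adds at most the column `a'` to
`E_A²` and the row `b'` to `π₁(E ∩ B²)` WHATEVER ITS SIZE, and a run has at most `|σ_X(e)|` steps. Hence along every run
`|E_A²(ε_i)| ≤ |E_A²(e)| + |σ_X(e)| ≤ (1 + max Δ)|e|` (same for `B`), Lemma 8 (i) keeps supplying a flip of positive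
decrease (`exists_flip_third_of_proj`) so the run never fails, and the final zero-syndrome word is a stabilizer element
by the projection form of Cor 5 (`mem_rowSpace_of_syndrome_eq_zero_of_proj`):

* `exists_flip_third_of_proj` — Lemma 8 (i) for ANY word with `σ_X ≠ 0` and small projections (no reducedness);
* `ssfRun_corrects_of_proj` — the run induction with the invariant `|E_A²(ε)| + |σ_X(ε)| ≤ γ_A n_A`,
  `|π₁(E∩B²)(ε)| + |σ_X(ε)| ≤ γ_B n_B`, for every threshold `κ ≤ 1/3` (Algorithm 1 is `κ = 0`);
* `ssfDecoder_corrects_of_proj` and ★ `ssfDecoder_corrects_of_weight_le` — every small-set-flip decoder with threshold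
  `κ ≤ 1/3` corrects every `X`-error `e` with `(1 + max(Δ_A,Δ_B))·|e| ≤ min(γ_A n_A, γ_B n_B)`; `_transpose` (Z-sector).

STATUS / HONEST FRAMING: OURS, NOT a printed statement — the printed Theorem 2 (tree: `LTZ15_theorem2_le_holds`,
`ltz15_theorem2_max`) has radius `w₀ = R/(3(1 + Δ_B))`, strict; ours is `R/(1 + max Δ)`, non-strict, i.e. the printed
hypothesis implies ours (`ltz15_theorem2_max_of_proj` re-derives the convention-free printed form), and it holds for every
threshold `κ ∈ [0, 1/3]`, not only Algorithm 1. Same hypotheses otherwise (`δ_A, δ_B < 1/6`, biregular, `δ ≥ 0`).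
PROVED (kernel axioms); no definitions, no named facts.
-/

namespace Summit.Ventures.QEC.Expanders

open Finset Matrix Literature.InformationTheory.QuantumCodes Literature.InformationTheory.QuantumCodes.QuantumExpander

variable {A B : Type*} [Fintype A] [Fintype B] [DecidableEq A] [DecidableEq B]

/-! ### Lemma 8 (i) for an arbitrary word with small projections -/

/-- **LTZ15 Lemma 8 (i) without reducedness**: for a `(Δ_A,Δ_B)`-biregular `(γ_A,δ_A,γ_B,δ_B)`-expander with
`0 ≤ δ_A, δ_B < 1/6`, every word `e` with `σ_X(e) ≠ 0` whose projections satisfy `|E_A²| ≤ γ_A n_A`, `|π₁(E∩B²)| ≤ γ_B n_B`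
admits a small set `F` (inside one generator) with `|F| ≤ 3(|σ_X(e)| − |σ_X(e ⊕ 𝟙_F)|)` — in particular a flip of positive
decrease. Proof: induction on `|e|`; at a critical generator (`exists_isCritical_of_proj`) either the degenerate flip
(`card_le_decrease_of_degenerate`) or the local four cases (`exists_flip_third_of_isCritical`) apply, or `e` is replaced by
the lighter word `e ⊕ 𝟙(g_{ba})` with the same syndrome and no larger projections. STATUS: ours (the printed lemma assumes
`w_R(e) ≤ min(γ_A n_A, γ_B n_B)`). [cite: LeverrierTillichZemor2015, Lemma 8 (arXiv v1 p0008 L104-110), App. B (p0013–p0014), App. A (p0012)] -/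
theorem exists_flip_third_of_proj (H : Matrix B A (ZMod 2)) {dA dB : ℕ} {γA δA γB δB : ℝ}
    (hreg : IsBiregular H dA dB) (hexp : IsLeftRightExpanding H dA dB γA δA γB δB)
    (hdA : 0 < dA) (hdB : 0 < dB) (hδA : 0 ≤ δA) (hδA' : δA < 1 / 6) (hδB : 0 ≤ δB) (hδB' : δB < 1 / 6)
    (e : (A × A) ⊕ (B × B) → ZMod 2) (hσ : expanderHX H *ᵥ e ≠ 0)
    (heA : ((projA (supp e)).card : ℝ) ≤ γA * Fintype.card A)
    (heB : ((projB (supp e)).card : ℝ) ≤ γB * Fintype.card B) :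
    ∃ F ∈ smallSets (expanderHZ H),
      (F.card : ℝ) ≤ 3 * syndromeDecrease (expanderHX H) (expanderHX H *ᵥ e) F := by
  classical
  suffices h : ∀ n : ℕ, ∀ f : (A × A) ⊕ (B × B) → ZMod 2, hammingNorm f ≤ n →
      expanderHX H *ᵥ f ≠ 0 →
      ((projA (supp f)).card : ℝ) ≤ γA * Fintype.card A →
      ((projB (supp f)).card : ℝ) ≤ γB * Fintype.card B →
      ∃ F ∈ smallSets (expanderHZ H),
        (F.card : ℝ) ≤ 3 * syndromeDecrease (expanderHX H) (expanderHX H *ᵥ f) F from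
    h _ e le_rfl hσ heA heB
  intro n
  induction n with
  | zero =>
    intro f hf hσf _ _
    exfalso
    have hfz : f = 0 := hammingNorm_eq_zero.1 (Nat.le_zero.1 hf)
    exact hσf (by rw [hfz, Matrix.mulVec_zero])
  | succ n ih =>
    intro f hf hσf hfA hfB
    have hfz : f ≠ 0 := by
      intro h0; exact hσf (by rw [h0, Matrix.mulVec_zero])
    have hE0 : (supp f).Nonempty := by
      by_contra h0
      rw [Finset.not_nonempty_iff_eq_empty] at h0
      apply hfz
      ext q
      by_contra hq
      have : q ∈ supp f := by simpa [supp] using hq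
      rw [h0] at this
      exact Finset.notMem_empty _ this
    obtain ⟨b, a, Χa, Χb, hc⟩ := exists_isCritical_of_proj H hreg hexp hdA hdB hδA hδB (supp f) hE0 hfA hfB
    by_cases hdeg : critX H f b a Χa = ∅ ∨ critY H f b a Χb = ∅
    · refine ⟨critFlip H f b a Χa Χb, critFlip_mem_smallSets hc, ?_⟩
      have hdec := card_le_decrease_of_degenerate H hreg hdA hdB hδA' hδB' hc hdeg
      have : (0 : ℝ) ≤ (critFlip H f b a Χa Χb).card := Nat.cast_nonneg _
      linarith
    · rw [not_or] at hdeg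
      have haP : a ∈ projA (supp f) :=
        mem_projA_of_critX_nonempty (Finset.nonempty_iff_ne_empty.2 hdeg.1)
      have hbP : b ∈ projB (supp f) :=
        mem_projB_of_critY_nonempty (Finset.nonempty_iff_ne_empty.2 hdeg.2)
      by_cases hloc : hammingNorm f ≤ hammingNorm (f + expanderHZ H (b, a))
      · obtain ⟨F, hFs, -, hF3⟩ := exists_flip_third_of_isCritical H hreg hdA hdB hδA' hδB' hc hloc
        exact ⟨F, hFs, hF3⟩
      · push Not at hloc
        set g : (A × A) ⊕ (B × B) → ZMod 2 := expanderHZ H (b, a) with hg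
        have hgmem : g ∈ rowSpace (expanderHZ H) := expanderHZ_row_mem_rowSpace H b a
        have hsyn : expanderHX H *ᵥ (f + g) = expanderHX H *ᵥ f := by
          rw [Matrix.mulVec_add, expanderHX_mulVec_eq_zero_of_mem_rowSpace H hgmem, add_zero]
        have hsuppg : supp g ⊆ genSupport (expanderHZ H) (b, a) := by
          intro q hq; simpa [supp, genSupport] using hq
        have hA' : projA (supp (f + g)) ⊆ projA (supp f) := by
          rw [← Finset.insert_eq_of_mem haP]; exact projA_supp_add_subset H f g b a hsuppg
        have hB' : projB (supp (f + g)) ⊆ projB (supp f) := by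
          rw [← Finset.insert_eq_of_mem hbP]; exact projB_supp_add_subset H f g b a hsuppg
        obtain ⟨F, hFs, hF3⟩ := ih (f + g) (by omega) (by rw [hsyn]; exact hσf)
          (le_trans (by exact_mod_cast Finset.card_le_card hA') hfA)
          (le_trans (by exact_mod_cast Finset.card_le_card hB') hfB)
        exact ⟨F, hFs, by rw [hsyn] at hF3; exact hF3⟩

/-! ### The run induction: count steps, not weights -/

/-- A small set lies inside one generator `g_{ba}`. [cite: FawziGrospellierLeverrier2018, §2.3 (𝓕 = {F ⊆ x : x ∈ 𝒳})] -/
theorem exists_subset_genSupport_of_mem_smallSets {H : Matrix B A (ZMod 2)} {F : Finset ((A × A) ⊕ (B × B))}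
    (hF : F ∈ smallSets (expanderHZ H)) : ∃ (b : B) (a : A), F ⊆ genSupport (expanderHZ H) (b, a) := by
  rw [smallSets, Finset.mem_erase] at hF
  obtain ⟨g, -, hg⟩ := Finset.mem_biUnion.1 hF.2
  exact ⟨g.1, g.2, Finset.mem_powerset.1 hg⟩

/-- **The run invariant (ours, replacing LTZ15 Lemma 10's eq. (epsilon))**: along a complete valid run of any
small-set-flip decoder with threshold `κ ≤ 1/3` from `σ = σ_X(ε)`, the quantity `|E_A²(ε)| + |σ_X(ε)|` (and its `B`-side
twin) never increases — each step adds at most one column / one row to the projections and removes at least one syndrome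
bit — so if initially `|E_A²(ε)| + |σ_X(ε)| ≤ γ_A n_A` and `|π₁(E∩B²)(ε)| + |σ_X(ε)| ≤ γ_B n_B`, the run never halts at a
non-zero syndrome (`exists_flip_third_of_proj` supplies a flip of ratio `≥ 1/3 ≥ κ`) and ends with `ε ⊕ Ê ∈ C_Z^⊥`
(`mem_rowSpace_of_syndrome_eq_zero_of_proj`). [cite: LeverrierTillichZemor2015, Lemma 10 proof (arXiv v1 p0009 L40-75) with Lemma 7 / App. A (p0012)] -/
theorem ssfRun_corrects_of_proj (H : Matrix B A (ZMod 2)) {dA dB : ℕ} {γA δA γB δB : ℝ}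
    (hreg : IsBiregular H dA dB) (hexp : IsLeftRightExpanding H dA dB γA δA γB δB)
    (hdA : 0 < dA) (hdB : 0 < dB) (hδA : 0 ≤ δA) (hδA' : δA < 1 / 6) (hδB : 0 ≤ δB) (hδB' : δB < 1 / 6)
    {κ : ℝ} (hκ : κ ≤ 1 / 3)
    {σ : A × B → ZMod 2} {l : List (Finset ((A × A) ⊕ (B × B)))}
    (hrun : IsSSFRun κ (expanderHX H) (expanderHZ H) σ l) :
    ∀ ε : (A × A) ⊕ (B × B) → ZMod 2, expanderHX H *ᵥ ε = σ →
      ((projA (supp ε)).card : ℝ) + hammingNorm σ ≤ γA * Fintype.card A →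
      ((projB (supp ε)).card : ℝ) + hammingNorm σ ≤ γB * Fintype.card B →
      ε + runOutput l ∈ rowSpace (expanderHZ H) := by
  classical
  induction hrun with
  | @halt σ hh =>
    intro ε hε hA hB
    have hout : runOutput ([] : List (Finset ((A × A) ⊕ (B × B)))) = 0 := by simp [runOutput]
    rw [hout, add_zero]
    have hσ0 : (0 : ℝ) ≤ hammingNorm σ := Nat.cast_nonneg _
    have hA' : ((projA (supp ε)).card : ℝ) ≤ γA * Fintype.card A := by linarith
    have hB' : ((projB (supp ε)).card : ℝ) ≤ γB * Fintype.card B := by linarith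
    by_cases hz : expanderHX H *ᵥ ε = 0
    · exact mem_rowSpace_of_syndrome_eq_zero_of_proj H hreg hexp hdA hdB hδA hδA' hδB hδB' hz hA' hB'
    · exfalso
      obtain ⟨F, hF, hF3⟩ := exists_flip_third_of_proj H hreg hexp hdA hdB hδA hδA' hδB hδB' ε hz hA' hB'
      rw [hε] at hF3
      have hFpos : (1 : ℝ) ≤ F.card := by exact_mod_cast card_pos_of_mem_smallSets hF
      have hdposR : (0 : ℝ) < syndromeDecrease (expanderHX H) σ F := by linarith
      have hdpos : 0 < syndromeDecrease (expanderHX H) σ F := by exact_mod_cast hdposR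
      refine hh F hF ⟨hdpos, ?_⟩
      have : κ * F.card ≤ 1 / 3 * F.card := mul_le_mul_of_nonneg_right hκ (by linarith)
      linarith
  | @step σ F l hF hrest ih =>
    intro ε hε hA hB
    obtain ⟨hFmem, hdecpos, _, _⟩ := hF
    obtain ⟨b, a, hFg⟩ := exists_subset_genSupport_of_mem_smallSets hFmem
    -- the new word and its syndrome
    have hε' : expanderHX H *ᵥ (ε + flipVec F) = σ + expanderHX H *ᵥ flipVec F := by
      rw [Matrix.mulVec_add, hε]
    have hdec : (hammingNorm (σ + expanderHX H *ᵥ flipVec F) : ℝ) + 1 ≤ hammingNorm σ := by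
      have h1 : (1 : ℤ) ≤ syndromeDecrease (expanderHX H) σ F := hdecpos
      rw [syndromeDecrease] at h1
      have : (hammingNorm (σ + expanderHX H *ᵥ flipVec F) : ℤ) + 1 ≤ hammingNorm σ := by linarith
      exact_mod_cast this
    -- the projections grow by at most the column `a` / the row `b`
    have hsuppF : supp (flipVec F) ⊆ genSupport (expanderHZ H) (b, a) := by rw [supp_flipVec]; exact hFg
    have hA1 : ((projA (supp (ε + flipVec F))).card : ℝ) ≤ (projA (supp ε)).card + 1 := by
      have h1 := Finset.card_le_card (projA_supp_add_subset H ε (flipVec F) b a hsuppF)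
      have h2 := Finset.card_insert_le a (projA (supp ε))
      exact_mod_cast h1.trans h2
    have hB1 : ((projB (supp (ε + flipVec F))).card : ℝ) ≤ (projB (supp ε)).card + 1 := by
      have h1 := Finset.card_le_card (projB_supp_add_subset H ε (flipVec F) b a hsuppF)
      have h2 := Finset.card_insert_le b (projB (supp ε))
      exact_mod_cast h1.trans h2
    have hres := ih (ε + flipVec F) hε' (by linarith) (by linarith)
    rw [runOutput_cons, ← add_assoc]
    exact hres

/-- **Every small-set-flip decoder of threshold `κ ≤ 1/3` corrects every `X`-error whose projections and syndrome satisfy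
`|E_A²| + |σ_X(e)| ≤ γ_A n_A`, `|π₁(E∩B²)| + |σ_X(e)| ≤ γ_B n_B`** (`0 ≤ δ_A, δ_B < 1/6`, biregular, any degrees). STATUS:
OURS. [cite: LeverrierTillichZemor2015, Thm 2 / Lemma 10 (arXiv v1 p0006 L15-22, p0009 L40-75)] -/
theorem ssfDecoder_corrects_of_proj (H : Matrix B A (ZMod 2)) {dA dB : ℕ} {γA δA γB δB : ℝ}
    (hreg : IsBiregular H dA dB) (hexp : IsLeftRightExpanding H dA dB γA δA γB δB)
    (hdA : 0 < dA) (hdB : 0 < dB) (hδA : 0 ≤ δA) (hδA' : δA < 1 / 6) (hδB : 0 ≤ δB) (hδB' : δB < 1 / 6)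
    {κ : ℝ} (hκ : κ ≤ 1 / 3) (D : Decoder (A × B → ZMod 2) ((A × A) ⊕ (B × B) → ZMod 2))
    (hD : IsSSFDecoder κ (expanderHX H) (expanderHZ H) D) (e : (A × A) ⊕ (B × B) → ZMod 2)
    (heA : ((projA (supp e)).card : ℝ) + hammingNorm (expanderHX H *ᵥ e) ≤ γA * Fintype.card A)
    (heB : ((projB (supp e)).card : ℝ) + hammingNorm (expanderHX H *ᵥ e) ≤ γB * Fintype.card B) :
    D.Corrects (fun x => expanderHX H *ᵥ x) (rowSpace (expanderHZ H) : Set _) e := by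
  classical
  obtain ⟨l, hrun, hDσ⟩ := hD (expanderHX H *ᵥ e)
  rw [Decoder.Corrects, hDσ, SetLike.mem_coe, add_comm]
  exact ssfRun_corrects_of_proj H hreg hexp hdA hdB hδA hδA' hδB hδB' hκ hrun e rfl heA heB

/-- ★ **Adversarial radius `min(γ_A n_A, γ_B n_B)/(1 + max(Δ_A, Δ_B))` for every small-set-flip decoder of threshold
`κ ≤ 1/3`** (three times the printed `w₀ = min/(3(1+Δ_B))` of LTZ15 Theorem 2, and non-strict): for a
`(Δ_A,Δ_B)`-biregular `(γ_A,δ_A,γ_B,δ_B)`-expander with `0 ≤ δ_A, δ_B < 1/6`, every such decoder corrects every `X`-error `e`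
with `(1 + max(Δ_A,Δ_B))·|e| ≤ min(γ_A n_A, γ_B n_B)`. Proof: `|E_A²|, |π₁(E∩B²)| ≤ |e|` and `|σ_X(e)| ≤ max Δ·|e|`
(`hammingNorm_expanderHX_mulVec_le_max`), then `ssfDecoder_corrects_of_proj`. STATUS: OURS, NOT the printed statement
(stronger conclusion under a weaker hypothesis; the printed form is re-derived below).
[cite: LeverrierTillichZemor2015, Thm 2 eq. (w0) (arXiv v1 p0006 L15-22) and Lemma 10 (p0009 L40-75)] -/
theorem ssfDecoder_corrects_of_weight_le (H : Matrix B A (ZMod 2)) {dA dB : ℕ} {γA δA γB δB : ℝ}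
    (hreg : IsBiregular H dA dB) (hexp : IsLeftRightExpanding H dA dB γA δA γB δB)
    (hdA : 0 < dA) (hdB : 0 < dB) (hδA : 0 ≤ δA) (hδA' : δA < 1 / 6) (hδB : 0 ≤ δB) (hδB' : δB < 1 / 6)
    {κ : ℝ} (hκ : κ ≤ 1 / 3) (D : Decoder (A × B → ZMod 2) ((A × A) ⊕ (B × B) → ZMod 2))
    (hD : IsSSFDecoder κ (expanderHX H) (expanderHZ H) D) (e : (A × A) ⊕ (B × B) → ZMod 2)
    (he : (1 + ((max dA dB : ℕ) : ℝ)) * hammingNorm e ≤ min (γA * Fintype.card A) (γB * Fintype.card B)) :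
    D.Corrects (fun x => expanderHX H *ᵥ x) (rowSpace (expanderHZ H) : Set _) e := by
  classical
  have hsupp : (supp e).card = hammingNorm e := by simp [supp, hammingNorm]
  have hσ : (hammingNorm (expanderHX H *ᵥ e) : ℝ) ≤ ((max dA dB : ℕ) : ℝ) * hammingNorm e := by
    exact_mod_cast hammingNorm_expanderHX_mulVec_le_max H hreg e
  have hpA : ((projA (supp e)).card : ℝ) ≤ hammingNorm e := by
    rw [← hsupp]; exact_mod_cast card_projA_le (supp e)
  have hpB : ((projB (supp e)).card : ℝ) ≤ hammingNorm e := by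
    rw [← hsupp]; exact_mod_cast card_projB_le (supp e)
  refine ssfDecoder_corrects_of_proj H hreg hexp hdA hdB hδA hδA' hδB hδB' hκ D hD e ?_ ?_
  · have := min_le_left (γA * Fintype.card A) (γB * Fintype.card B)
    nlinarith
  · have := min_le_right (γA * Fintype.card A) (γB * Fintype.card B)
    nlinarith

/-- The printed radius implies ours: `|e| < min/(3(1 + max Δ))` gives `(1 + max Δ)|e| ≤ min` — so the convention-free
printed Theorem 2 (`ltz15_theorem2_max`, Algorithm 1 = `κ = 0`) is a special case of `ssfDecoder_corrects_of_weight_le`.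
[cite: LeverrierTillichZemor2015, Thm 2 (arXiv v1 p0006 L15-22)] -/
theorem ltz15_theorem2_max_of_proj (H : Matrix B A (ZMod 2)) {dA dB : ℕ} {γA δA γB δB : ℝ}
    (hreg : IsBiregular H dA dB) (hexp : IsLeftRightExpanding H dA dB γA δA γB δB)
    (hdA : 0 < dA) (hdB : 0 < dB) (hδA : 0 ≤ δA) (hδA' : δA < 1 / 6) (hδB : 0 ≤ δB) (hδB' : δB < 1 / 6)
    (D : Decoder (A × B → ZMod 2) ((A × A) ⊕ (B × B) → ZMod 2))
    (hD : IsSSFDecoder 0 (expanderHX H) (expanderHZ H) D) (e : (A × A) ⊕ (B × B) → ZMod 2)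
    (he : (hammingNorm e : ℝ)
      < 1 / (3 * (1 + (max dA dB : ℕ))) * min (γA * Fintype.card A) (γB * Fintype.card B)) :
    D.Corrects (fun x => expanderHX H *ᵥ x) (rowSpace (expanderHZ H) : Set _) e := by
  refine ssfDecoder_corrects_of_weight_le H hreg hexp hdA hdB hδA hδA' hδB hδB' (κ := 0) (by norm_num) D hD e ?_
  set M := min (γA * Fintype.card A) (γB * Fintype.card B) with hM
  set m : ℝ := ((max dA dB : ℕ) : ℝ) with hm
  have hm0 : 0 ≤ m := by rw [hm]; exact Nat.cast_nonneg _
  have h0 : (0 : ℝ) ≤ hammingNorm e := Nat.cast_nonneg _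
  have hM0 : 0 ≤ M := by
    by_contra hneg
    push Not at hneg
    have : 1 / (3 * (1 + m)) * M < 0 := mul_neg_of_pos_of_neg (by positivity) hneg
    linarith
  have h1 : (1 + m) * hammingNorm e ≤ (1 + m) * (1 / (3 * (1 + m)) * M) :=
    mul_le_mul_of_nonneg_left he.le (by positivity)
  have h2 : (1 + m) * (1 / (3 * (1 + m)) * M) = M / 3 := by
    field_simp
  rw [h2] at h1
  linarith

/-- **`Z`-sector / reversed graph**: the same radius for the small-set-flip decoders of `Q_{Gᵀ}` (degrees `(Δ_B, Δ_A)`),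
for EVERY biregular expander. [cite: LeverrierTillichZemor2015, Thm 2 and §3 ("the other case being symmetric"; arXiv v1 p0007 L40-44)] -/
theorem ssfDecoder_corrects_of_weight_le_transpose (H : Matrix B A (ZMod 2)) {dA dB : ℕ} {γA δA γB δB : ℝ}
    (hreg : IsBiregular H dA dB) (hexp : IsLeftRightExpanding H dA dB γA δA γB δB)
    (hdA : 0 < dA) (hdB : 0 < dB) (hδA : 0 ≤ δA) (hδA' : δA < 1 / 6) (hδB : 0 ≤ δB) (hδB' : δB < 1 / 6)
    {κ : ℝ} (hκ : κ ≤ 1 / 3) (D : Decoder (B × A → ZMod 2) ((B × B) ⊕ (A × A) → ZMod 2))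
    (hD : IsSSFDecoder κ (expanderHX Hᵀ) (expanderHZ Hᵀ) D) (e : (B × B) ⊕ (A × A) → ZMod 2)
    (he : (1 + ((max dA dB : ℕ) : ℝ)) * hammingNorm e ≤ min (γA * Fintype.card A) (γB * Fintype.card B)) :
    D.Corrects (fun x => expanderHX Hᵀ *ᵥ x) (rowSpace (expanderHZ Hᵀ) : Set _) e := by
  have hregT : IsBiregular Hᵀ dB dA := isBiregular_transpose H hreg
  have hexpT : IsLeftRightExpanding Hᵀ dB dA γB δB γA δA := by
    refine ⟨(isLeftExpanding_transpose_iff H dB γB δB).2 hexp.2, ?_⟩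
    have h : IsLeftExpanding Hᵀᵀ dA γA δA := by rw [Matrix.transpose_transpose]; exact hexp.1
    exact (isLeftExpanding_transpose_iff Hᵀ dA γA δA).1 h
  refine ssfDecoder_corrects_of_weight_le Hᵀ hregT hexpT hdB hdA hδB hδB' hδA hδA' hκ D hD e ?_
  rwa [max_comm, min_comm]

/-- **`Z`-sector of `Q_G` in its own coordinates**: every small-set-flip decoder `D_Z` of threshold `κ ≤ 1/3` for the
pair (syndromes `H_Z = expanderHZ H`, generators `H_X = expanderHX H`) corrects every `Z`-error `e` with
`(1 + max(Δ_A,Δ_B))·|e| ≤ min(γ_A n_A, γ_B n_B)` (the reversed-graph statement transported along the block swap, as in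
`ltz15_theorem2_zsector`). STATUS: OURS. [cite: LeverrierTillichZemor2015, Thm 2 (arXiv v1 p0006) with §2 ("exchanging the roles of A and B"; p0005)] -/
theorem ssfDecoder_corrects_of_weight_le_zsector (H : Matrix B A (ZMod 2)) {dA dB : ℕ} {γA δA γB δB : ℝ}
    (hreg : IsBiregular H dA dB) (hexp : IsLeftRightExpanding H dA dB γA δA γB δB)
    (hdA : 0 < dA) (hdB : 0 < dB) (hδA : 0 ≤ δA) (hδA' : δA < 1 / 6) (hδB : 0 ≤ δB) (hδB' : δB < 1 / 6)
    {κ : ℝ} (hκ : κ ≤ 1 / 3) (D : Decoder (B × A → ZMod 2) ((A × A) ⊕ (B × B) → ZMod 2))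
    (hD : IsSSFDecoder κ (expanderHZ H) (expanderHX H) D) (e : (A × A) ⊕ (B × B) → ZMod 2)
    (he : (1 + ((max dA dB : ℕ) : ℝ)) * hammingNorm e ≤ min (γA * Fintype.card A) (γB * Fintype.card B)) :
    D.Corrects (fun x => expanderHZ H *ᵥ x)
      (rowSpace (expanderHX H) : Set ((A × A) ⊕ (B × B) → ZMod 2)) e := by
  set σ := Equiv.sumComm (A × A) (B × B) with hσ
  rw [expanderHZ_eq_submatrix_swap H, expanderHX_eq_submatrix_swap H] at hD ⊢
  have hD' := isSSFDecoder_comp_equiv σ hD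
  have he' : (1 + ((max dB dA : ℕ) : ℝ)) * hammingNorm (e ∘ σ.symm)
      ≤ min (γB * Fintype.card B) (γA * Fintype.card A) := by
    rw [hammingNorm_comp_equiv e σ, max_comm, min_comm]; exact he
  have h := ssfDecoder_corrects_of_weight_le_transpose H hreg hexp hdA hdB hδA hδA' hδB hδB' hκ _ hD'
    (e ∘ σ.symm) (by rw [max_comm, min_comm]; exact he')
  exact (corrects_comp_equiv_iff σ D e).1 h

/-! ### Appended (qec-type-04 g7, lead g9 block 226 (2) / 227 (1)): comparison with the Δ-free radius IN PRINT

FGL18a (Fawzi–Grospellier–Leverrier, arXiv:1711.08351v2) Def. 10 + Prop. 11 (§3.2, p0011 L4-24) give, for the `β₀`-rule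
small-set-flip decoder, the adversarial radius `t_SSF(β₀) ≥ (rβ₀/(1+β₀))·min(γ_A n_A, γ_B n_B)` (`r = d_A/d_B`, `β₀ > 0` once
`δ_A, δ_B < 1/8`), and Remark 9 (p0011 L1-2) transfers it to every threshold `κ ≤ β₀ d_B`, Algorithm 1 of LTZ15 included —
in the tree: `QuantumExpander.fgl18_proposition11_minmax_of_le` (convention-free, radius
`(min Δ/max Δ)·(β̃/(1+β̃))·min(γ_A n_A, γ_B n_B)`, `β̃ = betaZero (min Δ) (max Δ) δ_A δ_B`). That printed radius does not decay
with the degree and EXCEEDS this file's `min/(1 + max Δ)` for balanced degrees `≥ 3`; ours is larger only for unbalanced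
degrees or `δ` near `1/8`, and it is the one available on the wider range `δ < 1/6` (where `β̃` may be `≤ 0`). The theorem
below records the union of the two certified regimes for one decoder. -/

/-- **The two certified adversarial radii together** (LTZ15/this file: `min/(1 + max Δ)` for `δ < 1/6`, `κ ≤ 1/3`; FGL18a
Prop. 11 + Remark 9, tree form `fgl18_proposition11_minmax_of_le`: `(min Δ/max Δ)(β̃/(1+β̃))·min` for `β̃ > 0`, `κ ≤ β̃·max Δ`):
a small-set-flip decoder whose threshold satisfies both `κ ≤ 1/3` and `κ ≤ β̃·max(Δ_A,Δ_B)` (e.g. Algorithm 1, `κ = 0`), on a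
biregular expander with `0 < δ_A, δ_B < 1/6` and `β̃ > 0`, corrects every `X`-error whose weight is within EITHER radius.
STATUS: a disjunction of the tree's two theorems (ours = the first disjunct; the second is the printed FGL18a radius).
[cite: FawziGrospellierLeverrier2018, Def 10, Prop 11 and Remark 9 (§3.2, arXiv v2 p0011 L1-24)] [cite: LeverrierTillichZemor2015, Thm 2 (arXiv v1 p0006 L15-22)] -/
theorem ssfDecoder_corrects_of_weight_le_or_prop11 (H : Matrix B A (ZMod 2)) {dA dB : ℕ} {γA δA γB δB : ℝ}
    (hreg : IsBiregular H dA dB) (hexp : IsLeftRightExpanding H dA dB γA δA γB δB)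
    (hdA : 0 < dA) (hdB : 0 < dB) (hδA : 0 < δA) (hδA' : δA < 1 / 6) (hδB : 0 < δB) (hδB' : δB < 1 / 6)
    (hβ : 0 < betaZero (min dA dB) (max dA dB) δA δB)
    {κ : ℝ} (hκ : κ ≤ 1 / 3) (hκβ : κ ≤ betaZero (min dA dB) (max dA dB) δA δB * ((max dA dB : ℕ) : ℝ))
    (D : Decoder (A × B → ZMod 2) ((A × A) ⊕ (B × B) → ZMod 2))
    (hD : IsSSFDecoder κ (expanderHX H) (expanderHZ H) D) (e : (A × A) ⊕ (B × B) → ZMod 2)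
    (he : (1 + ((max dA dB : ℕ) : ℝ)) * hammingNorm e ≤ min (γA * Fintype.card A) (γB * Fintype.card B) ∨
      (hammingNorm e : ℝ) ≤
        ((min dA dB : ℕ) : ℝ) / ((max dA dB : ℕ) : ℝ) * betaZero (min dA dB) (max dA dB) δA δB
          / (1 + betaZero (min dA dB) (max dA dB) δA δB) * min (γA * Fintype.card A) (γB * Fintype.card B)) :
    D.Corrects (fun x => expanderHX H *ᵥ x) (rowSpace (expanderHZ H) : Set _) e := by
  rcases he with h | h
  · exact ssfDecoder_corrects_of_weight_le H hreg hexp hdA hdB hδA.le hδA' hδB.le hδB' hκ D hD e h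
  · exact fgl18_proposition11_minmax_of_le H hreg hexp hdA hdB hδA hδB hβ hκβ hD h

end Summit.Ventures.QEC.Expanders
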